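import Mathlib
import Summits.HodgeConjecture.FermatCycles.HodgeFermatTwistedMomentA

/-!
# LEMMA E (m₀ = 3) in algebraic form: twisted moments of a CM type — part 2 (`HodgeFermat/TwistedMoment.lean`)

Tree copy (part 2 of 2) of the module `HodgeFermat/TwistedMoment.lean` of the sibling cell's standalone package
`run/shared/lean/pub/pub-hodgefermat/lean/HodgeFermat/` (554 lines, sha256 `fc1f2106c3deb52f…`), source lines 302–554 (the μ-identity, the constants `S′`, `S_{3n}(ψ)`, canonical form, cross-check with THEOREM (Σν)).
Filed by cell `pub-hfermat`, seat prover-1 gen-0, on the COORDINATOR KEEPER RULING of 2026-08-25 (gem sweep H1: take the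
off-gate kernel theorem `thmFstar` — `HodgeFermat/DecodingFinal.lean:29` — through the gate); this file is one link of the
minimal import closure of `thmFstar`.  The source module's declarations are VERBATIM those of the cell record
`check/DecodingFinal_standalone.lean` (27 bodies, 454 223 B, sha256 dca6f17de93119a6…, hub `lean check` rc 0, 130.1 s; pub-hodgefermat `CERT.md` l.978, GATE HF-G32).
Deviations from the source module, exhaustively: the `import` lines (tree modules `Summits.HodgeConjecture.FermatCycles.
HodgeFermat*` instead of `HodgeFermat.*`); this module docstring; the namespace/`open`/`variable` preamble (source l.48–56) is repeated at the top because the module is split; one-line docstrings added (gate lint) to `coprime_three_mul_iff`, `muw_eq`. The module docstring is quoted in full in part 1.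
Every other line — in particular every declaration's statement and proof — is byte-identical to the source.
HONEST FRAMING: explicit algebraic cycles for specific Hodge classes on Fermat/Delsarte varieties; residual open instances
listed; no claim on general Hodge.  (This file is arithmetic of CM types; it claims nothing about cycles.)
-/

set_option autoImplicit false

namespace HodgeFermat.KRFree.TwistedMoment

open Finset HodgeFermat.KRFree.LemmaN
open HodgeFermat.KRFree.ChiThree (units coprime_mod_iff card_units not_three_dvd_of_coprime)

variable {R : Type*} [CommRing R]

/-! ## The μ-identity (characters of ℤ/n), two-constant form -/

/-- weight of an entry in the μ-identity: `ψ̄(x)·S_{3n}(ψ)` for `3 ∤ x`, `ψ̄(x/3)·S′` for `3 ∣ x` -/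
def muw (n : ℕ) (ψ ψb : ℕ → R) (x : ℕ) : R :=
  if 3 ∣ x then ψb (x / 3) * moment₃ n ψ else ψb x * moment (3 * n) ψ

/-- **THE μ-IDENTITY, two-constant form** (LEMMA E, `m₀ = 3`, characters `1 × ψ`).  Let `ψ` be a character mod `n`
(`n > 1`, `3 ∤ n`) with conjugate `ψ̄`.  For two triples with zero sums mod `3n`, all entries units mod `n`, of the same
CM type:  `Σ_{x ∈ T} w(x) = Σ_{x ∈ T′} w(x)`,  `w(x) = ψ̄(x)·S_{3n}(ψ)` (`3 ∤ x`), `= ψ̄(x/3)·S′` (`3 ∣ x`). -/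
theorem mu_identity {n : ℕ} {ψ ψb : ℕ → R} (hψ : IsChar n ψ) (h1n : 1 < n) (h3n : ¬ 3 ∣ n)
    (hb : ∀ x, Nat.Coprime x n → ψ x * ψb x = 1)
    {a b c a' b' c' : ℕ} (hs : 3 * n ∣ a + b + c) (hs' : 3 * n ∣ a' + b' + c')
    (ha : Nat.Coprime a n) (hb_ : Nat.Coprime b n) (hc : Nat.Coprime c n)
    (ha' : Nat.Coprime a' n) (hb' : Nat.Coprime b' n) (hc' : Nat.Coprime c' n)
    (hT : SameType (3 * n) (a, b, c) (a', b', c')) :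
    muw n ψ ψb a + muw n ψ ψb b + muw n ψ ψb c = muw n ψ ψb a' + muw n ψ ψb b' + muw n ψ ψb c' := by
  have h1m : 1 < 3 * n := by omega
  have ev : ∀ x, Nat.Coprime x n → transform (3 * n) ψ x = muw n ψ ψb x := by
    intro x hx
    unfold muw
    by_cases h3 : 3 ∣ x
    · rw [if_pos h3]
      obtain ⟨x', rfl⟩ := h3
      have hx' : Nat.Coprime x' n := Nat.Coprime.coprime_mul_left hx
      rw [Nat.mul_div_cancel_left x' (by norm_num : 0 < 3)]
      exact transform_of_three_mul hψ h1n h3n hx' (hb x' hx')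
    · rw [if_neg h3]
      have hx3 : Nat.Coprime x (3 * n) :=
        Nat.Coprime.mul_right (Nat.coprime_comm.mp ((Nat.Prime.coprime_iff_not_dvd Nat.prime_three).mpr h3)) hx
      exact transform_of_coprime (hψ.of_mul 3) h1m hx3 (hb x hx)
  have nd : ∀ x, Nat.Coprime x n → ¬ 3 * n ∣ x := by
    intro x hx h
    have h1 : n ∣ Nat.gcd x n := Nat.dvd_gcd (dvd_trans (dvd_mul_left n 3) h) dvd_rfl
    rw [hx.gcd_eq_one] at h1
    exact absurd (Nat.le_of_dvd one_pos h1) (by omega)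
  have key := transform_sum_eq_of_sameType ψ (by omega) hs hs' (nd c hc) (nd c' hc') hT
  rw [ev a ha, ev b hb_, ev c hc, ev a' ha', ev b' hb', ev c' hc'] at key
  exact key

/-! ## The constants: `S′ = 6·S_n(ψ)` and `S_{3n}(ψ) = 3(1 − ψ(3))·S_n(ψ) + 3n·M_n(ψ)` -/

/-- `t` is prime to `3n` iff `3 ∤ t` and `t` is prime to `n` -/
lemma coprime_three_mul_iff {t n : ℕ} : Nat.Coprime t (3 * n) ↔ ¬ 3 ∣ t ∧ Nat.Coprime t n := by
  rw [Nat.coprime_mul_iff_right, Nat.coprime_comm (n := t) (m := 3),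
    Nat.Prime.coprime_iff_not_dvd Nat.prime_three]

/-- the units of `ℤ/3n` over the units `s` of `ℤ/n`: the lifts `s, s + n, s + 2n` that are prime to `3` -/
lemma sum_units_three_mul {M : Type*} [AddCommMonoid M] {n : ℕ} (F : ℕ → M) :
    ∑ t ∈ units (3 * n), F t = ∑ s ∈ units n,
      ((if ¬ 3 ∣ s then F s else 0) + (if ¬ 3 ∣ s + n then F (s + n) else 0)
        + (if ¬ 3 ∣ s + 2 * n then F (s + 2 * n) else 0)) := by
  have lhs : ∑ t ∈ units (3 * n), F t = ∑ t ∈ range (3 * n), if Nat.Coprime t (3 * n) then F t else 0 := by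
    unfold units; rw [Finset.sum_filter]
  have rhs : ∀ G : ℕ → M, ∑ s ∈ units n, G s = ∑ s ∈ range n, if Nat.Coprime s n then G s else 0 := by
    intro G; unfold units; rw [Finset.sum_filter]
  have hr : range (3 * n) = range (n + (n + n)) := by congr 1; ring
  rw [lhs, rhs, hr, Finset.sum_range_add, Finset.sum_range_add]
  have blk : ∀ k s : ℕ, (if Nat.Coprime (k * n + s) (3 * n) then F (k * n + s) else 0)
      = if Nat.Coprime s n then (if ¬ 3 ∣ s + k * n then F (s + k * n) else 0) else 0 := by
    intro k s
    rw [show k * n + s = s + k * n by ring]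
    by_cases hc : Nat.Coprime s n
    · rw [if_pos hc]
      have e : Nat.Coprime (s + k * n) (3 * n) ↔ ¬ 3 ∣ s + k * n := by
        rw [coprime_three_mul_iff]
        have h2 : Nat.Coprime (s + k * n) n := by
          apply (coprime_mod_iff _ n).mp
          rw [Nat.add_mul_mod_self_right]
          exact (coprime_mod_iff _ n).mpr hc
        exact ⟨fun h => h.1, fun h => ⟨h, h2⟩⟩
      by_cases h3 : 3 ∣ s + k * n
      · rw [if_neg (fun h => (e.mp h) h3), if_neg (fun h => h h3)]
      · rw [if_pos (e.mpr h3), if_pos h3]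
    · rw [if_neg hc]
      have e : ¬ Nat.Coprime (s + k * n) (3 * n) := by
        intro h
        apply hc
        have h2 := (coprime_three_mul_iff.mp h).2
        have h3 := (coprime_mod_iff (s + k * n) n).mpr h2
        rw [Nat.add_mul_mod_self_right] at h3
        exact (coprime_mod_iff s n).mp h3
      rw [if_neg e]
  have b0 : ∀ s, (if Nat.Coprime s (3 * n) then F s else 0)
      = if Nat.Coprime s n then (if ¬ 3 ∣ s then F s else 0) else 0 := by
    intro s; simpa only [zero_mul, zero_add, add_zero] using blk 0 s
  rw [← Finset.sum_add_distrib, ← Finset.sum_add_distrib]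
  refine Finset.sum_congr rfl (fun s _ => ?_)
  rw [b0 s, show n + (n + s) = 2 * n + s by ring, blk 2 s, show n + s = 1 * n + s by ring, blk 1 s, one_mul]
  by_cases hc : Nat.Coprime s n
  · simp only [if_pos hc, add_assoc]
  · simp only [if_neg hc, add_zero]

/-- for `3 ∤ n`, exactly one of `s, s + n, s + 2n` is divisible by `3` -/
lemma three_cases {n : ℕ} (h3n : ¬ 3 ∣ n) (s : ℕ) :
    (3 ∣ s ∧ ¬ 3 ∣ s + n ∧ ¬ 3 ∣ s + 2 * n) ∨ (¬ 3 ∣ s ∧ 3 ∣ s + n ∧ ¬ 3 ∣ s + 2 * n)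
      ∨ (¬ 3 ∣ s ∧ ¬ 3 ∣ s + n ∧ 3 ∣ s + 2 * n) := by
  have hn : n % 3 = 1 ∨ n % 3 = 2 := by omega
  have hs : s % 3 = 0 ∨ s % 3 = 1 ∨ s % 3 = 2 := by omega
  rcases hn with hn | hn <;> rcases hs with hs | hs | hs <;> omega

/-- **S′ and periodic weights**: a weight depending only on `t mod n` sums over the units of `ℤ/3n` to TWICE its sum
over the units of `ℤ/n` (each unit of `ℤ/n` has exactly two lifts prime to `3`) -/
theorem sum_units_three_mul_periodic {M : Type*} [AddCommMonoid M] {n : ℕ} (h3n : ¬ 3 ∣ n)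
    (G : ℕ → M) (hG : ∀ t, G (t % n) = G t) :
    ∑ t ∈ units (3 * n), G t = 2 • ∑ s ∈ units n, G s := by
  rw [sum_units_three_mul G, Finset.smul_sum]
  refine Finset.sum_congr rfl (fun s _ => ?_)
  have e1 : G (s + n) = G s := by rw [← hG (s + n), Nat.add_mod_right, hG]
  have e2 : G (s + 2 * n) = G s := by rw [← hG (s + 2 * n), Nat.add_mul_mod_self_right, hG]
  rw [e1, e2]
  rcases three_cases h3n s with ⟨h0, h1, h2⟩ | ⟨h0, h1, h2⟩ | ⟨h0, h1, h2⟩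
  all_goals
    simp only [h0, h1, h2, not_true_eq_false, not_false_eq_true, if_true, if_false, zero_add, add_zero, two_nsmul]

/-- `S′ = 6·S_n(ψ)` -/
theorem moment₃_eq {n : ℕ} {ψ : ℕ → R} (hψ : IsChar n ψ) (h3n : ¬ 3 ∣ n) :
    moment₃ n ψ = 6 * moment n ψ := by
  unfold moment₃
  rw [sum_units_three_mul_periodic h3n (fun t => ψ t * ((3 * (t % n) : ℕ) : R))
    (fun t => by simp only [Nat.mod_mod, hψ.periodic])]
  unfold moment
  rw [nsmul_eq_mul, Finset.mul_sum, Finset.mul_sum]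
  refine Finset.sum_congr rfl (fun s hs => ?_)
  simp only [units, mem_filter, mem_range] at hs
  rw [Nat.mod_eq_of_lt hs.1]
  push_cast
  ring

/-- the multiple of `3` among the lifts `s, s + n, s + 2n` -/
def mu3 (n s : ℕ) : ℕ := if 3 ∣ s then s else if 3 ∣ s + n then s + n else s + 2 * n

/-- it is `3·⟨s·3⁻¹⟩_n` -/
lemma mu3_eq {n s i : ℕ} (hn : 0 < n) (h3n : ¬ 3 ∣ n) (hs : s < n) (hi : 3 * i % n = 1) :
    mu3 n s = 3 * (s * i % n) := by
  have hA : 3 * (s * i % n) % n = s := by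
    rw [Nat.mul_mod, Nat.mod_mod, ← Nat.mul_mod, show 3 * (s * i) = s * (3 * i) by ring, Nat.mul_mod, hi,
      mul_one, Nat.mod_mod, Nat.mod_eq_of_lt hs]
  have hlt : s * i % n < n := Nat.mod_lt _ hn
  obtain ⟨q, hq, hqe⟩ : ∃ q, q < 3 ∧ 3 * (s * i % n) = n * q + s := by
    refine ⟨3 * (s * i % n) / n, ?_, ?_⟩
    · exact (Nat.div_lt_iff_lt_mul hn).mpr (by omega)
    · have h := Nat.div_add_mod (3 * (s * i % n)) n
      rw [hA] at h
      omega
  rw [hqe]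
  unfold mu3
  interval_cases q
  · split_ifs <;> omega
  · split_ifs <;> omega
  · split_ifs <;> omega

/-- `Σ_s ψ(s)·mu3(s) = 3ψ(3)·S_n(ψ)` (the substitution `s ↦ s·3⁻¹`) -/
lemma sum_mu3 {n : ℕ} {ψ : ℕ → R} (hψ : IsChar n ψ) (h1n : 1 < n) (h3n : ¬ 3 ∣ n) (h1 : ψ 1 = 1) :
    ∑ s ∈ units n, ψ s * (mu3 n s : R) = 3 * ψ 3 * moment n ψ := by
  have h3c : Nat.Coprime 3 n := (Nat.Prime.coprime_iff_not_dvd Nat.prime_three).mpr h3n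
  obtain ⟨i, -, hi⟩ := Nat.exists_mul_mod_eq_one_of_coprime h3c h1n
  have hic : Nat.Coprime i n := by
    have h0 : Nat.Coprime (3 * i % n) n := by rw [hi]; exact Nat.coprime_one_left n
    exact Nat.Coprime.coprime_mul_left ((coprime_mod_iff _ _).mp h0)
  have hb : ψ i * ψ 3 = 1 := by rw [← hψ.mul, mul_comm, ← hψ.periodic, hi, h1]
  have key : ∀ s ∈ units n, ψ s * (mu3 n s : R) = 3 * ψ 3 * (ψ (s * i % n) * ((s * i % n : ℕ) : R)) := by
    intro s hs
    simp only [units, mem_filter, mem_range] at hs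
    rw [mu3_eq (by omega) h3n hs.1 hi, hψ.apply_eq_mul hb s]
    push_cast
    ring
  rw [Finset.sum_congr rfl key, ← Finset.mul_sum]
  unfold moment
  rw [sum_units_reindex h1n hic (fun u => ψ u * (u : R))]

/-- **`S_{3n}(ψ) = 3(1 − ψ(3))·S_n(ψ) + 3n·M_n(ψ)`** (the classical imprimitive-moment relation at the prime `3`) -/
theorem moment_three_mul {n : ℕ} {ψ : ℕ → R} (hψ : IsChar n ψ) (h1n : 1 < n) (h3n : ¬ 3 ∣ n) (h1 : ψ 1 = 1) :
    moment (3 * n) ψ = 3 * (1 - ψ 3) * moment n ψ + 3 * n * mass n ψ := by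
  have hper : ∀ t, ψ (t + n) = ψ t := fun t => by rw [← hψ.periodic (t + n), Nat.add_mod_right, hψ.periodic]
  have hper2 : ∀ t, ψ (t + 2 * n) = ψ t := fun t => by
    rw [← hψ.periodic (t + 2 * n), Nat.add_mul_mod_self_right, hψ.periodic]
  have blocks : ∀ s ∈ units n,
      ((if ¬ 3 ∣ s then ψ s * (s : R) else 0) + (if ¬ 3 ∣ s + n then ψ (s + n) * ((s + n : ℕ) : R) else 0)
        + (if ¬ 3 ∣ s + 2 * n then ψ (s + 2 * n) * ((s + 2 * n : ℕ) : R) else 0))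
        = ψ s * ((3 * s + 3 * n : ℕ) : R) - ψ s * (mu3 n s : R) := by
    intro s _
    rw [hper, hper2]
    unfold mu3
    rcases three_cases h3n s with ⟨h0, h1', h2⟩ | ⟨h0, h1', h2⟩ | ⟨h0, h1', h2⟩
    all_goals
      simp only [h0, h1', h2, not_true_eq_false, not_false_eq_true, if_true, if_false, zero_add, add_zero]
      push_cast; ring
  unfold moment
  rw [sum_units_three_mul (fun t => ψ t * (t : R)), Finset.sum_congr rfl blocks,
    Finset.sum_sub_distrib, sum_mu3 hψ h1n h3n h1]
  unfold moment mass
  rw [Finset.mul_sum, Finset.mul_sum, Finset.mul_sum, ← Finset.sum_add_distrib]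
  have e : ∀ s ∈ units n, ψ s * ((3 * s + 3 * n : ℕ) : R) = 3 * (1 - ψ 3) * (ψ s * (s : R)) + 3 * n * ψ s
      + 3 * ψ 3 * (ψ s * (s : R)) := by
    intro s _; push_cast; ring
  rw [Finset.sum_congr rfl e, Finset.sum_add_distrib, ← Finset.mul_sum]
  ring

/-- the mass of an odd character vanishes (when `2` is regular in `R`) -/
theorem mass_eq_zero_of_odd {n : ℕ} {ψ : ℕ → R} (hψ : IsChar n ψ) (h1n : 1 < n) (hodd : ψ (n - 1) = -1)
    (h2 : ∀ z : R, 2 * z = 0 → z = 0) : mass n ψ = 0 := by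
  have hc : Nat.Coprime (n - 1) n := by
    have e : Nat.gcd (n - 1) n = Nat.gcd (n - 1) ((n - 1) + 1) := by congr 1; omega
    rw [Nat.Coprime, e, Nat.gcd_self_add_right, Nat.gcd_one_right]
  have key := sum_units_reindex h1n hc ψ
  have pt : ∀ t ∈ units n, ψ (t * (n - 1) % n) = -ψ t := by
    intro t _
    rw [hψ.periodic, hψ.mul, hodd, mul_neg, mul_one]
  rw [Finset.sum_congr rfl pt, Finset.sum_neg_distrib] at key
  apply h2
  unfold mass
  linear_combination -key

/-- **THE μ-IDENTITY, canonical form.**  Under the hypotheses of `mu_identity`, with `ψ(1) = 1`: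
`3·S_n(ψ)·[(1 − ψ(3))·Σ_{3∤x} ψ̄(x) + 2·Σ_{3∣x} ψ̄(x/3)]_T + 3n·M_n(ψ)·[Σ_{3∤x} ψ̄(x)]_T` is the same for `T′`. -/
def mue (ψ ψb : ℕ → R) (x : ℕ) : R :=
  if 3 ∣ x then 2 * ψb (x / 3) else (1 - ψ 3) * ψb x

/-- the μ-weight in canonical form: `muw = 3·S_n(ψ)·mue + 3n·M_n(ψ)·nuw` -/
theorem muw_eq {n : ℕ} {ψ ψb : ℕ → R} (hψ : IsChar n ψ) (h1n : 1 < n) (h3n : ¬ 3 ∣ n) (h1 : ψ 1 = 1) (x : ℕ) :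
    muw n ψ ψb x = 3 * moment n ψ * mue ψ ψb x + 3 * n * mass n ψ * nuw ψb x := by
  unfold muw mue nuw
  by_cases h3 : 3 ∣ x
  · rw [if_pos h3, if_pos h3, if_pos h3, moment₃_eq hψ h3n]; ring
  · rw [if_neg h3, if_neg h3, if_neg h3, moment_three_mul hψ h1n h3n h1]; ring

/-! ## Cross-check: THEOREM (Σν) of `ChiThree.lean` is the instance `χ = χ₃ × 1`, `R = ℤ` of the ν-identity -/

open HodgeFermat.KRFree.ChiThree (chi3 nu S chi3_mul chi3_mod chi3_mul_self chi3_of_dvd) in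
/-- `S(3n)·ν(T) = S(3n)·ν(T′)` (`ChiThree.cm_eq` summed) as an instance of `nu_identity` -/
theorem S_mul_nu_eq (n a b c a' b' c' : ℕ) (hn : 0 < n) (h3n : ¬ 3 ∣ n)
    (hs : 3 * n ∣ a + b + c) (hs' : 3 * n ∣ a' + b' + c')
    (ha : 3 ∣ a ∨ Nat.Coprime a (3 * n)) (hb : 3 ∣ b ∨ Nat.Coprime b (3 * n))
    (hc : 3 ∣ c ∨ Nat.Coprime c (3 * n)) (ha' : 3 ∣ a' ∨ Nat.Coprime a' (3 * n))
    (hb' : 3 ∣ b' ∨ Nat.Coprime b' (3 * n)) (hc' : 3 ∣ c' ∨ Nat.Coprime c' (3 * n))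
    (hc0 : ¬ 3 * n ∣ c) (hc0' : ¬ 3 * n ∣ c') (hT : SameType (3 * n) (a, b, c) (a', b', c')) :
    S (3 * n) * nu (a, b, c) = S (3 * n) * nu (a', b', c') := by
  have hχ : IsChar (3 * n) chi3 := ⟨fun x => chi3_mod x (dvd_mul_right 3 n), chi3_mul⟩
  have hbar : ∀ x, Nat.Coprime x (3 * n) → chi3 x * chi3 x = 1 :=
    fun x hx => chi3_mul_self (not_three_dvd_of_coprime (dvd_mul_right 3 n) hx)
  have hram : ∀ j, Nat.Coprime j (3 * n) → j % 3 = 2 → j % n = 1 % n → ∀ z : ℤ, chi3 j * z = z → z = 0 := by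
    intro j _ hj3 _ z hz
    have e : chi3 j = -1 := by simp [chi3, hj3]
    rw [e] at hz
    linarith
  have key := nu_identity hχ hn h3n hbar hram hs hs' ha hb hc ha' hb' hc' hc0 hc0' hT
  have hw : ∀ x, nuw chi3 x = chi3 x := by
    intro x; unfold nuw
    by_cases h : 3 ∣ x
    · rw [if_pos h, chi3_of_dvd h]
    · rw [if_neg h]
  simp only [hw] at key
  exact key

end HodgeFermat.KRFree.TwistedMoment
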